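import Summits.QuantumFields.BalabanUV.T4Continuum.Support.NE7ConstraintSecondDerivativeRecursion
import Summits.QuantumFields.BalabanUV.T4Continuum.Support.NE7MultiplierAnnihilatesGaugeDirections
import HarnessLib

/-!
# NE7DiagonalGaugeCurve — THE DIAGONAL GAUGE CURVE IN THE EXPONENTIAL CHART AND THE ABSTRACT SECOND-ORDER INVARIANCE AT A LAGRANGIAN-CRITICAL POINT (kinematic half of
# ✓ `NE7BorderedHessianGaugeDegenerate`: the bordered Hessian of the constrained minimal action is degenerate along the fine stabiliser orbit; ROAD-G116 §4 (a)(iii) ∕ §6 (G3))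

Cell `pub-balaban`, rung (B)+1 sub-cell t4, lineage `b2b-balaban-t4-ne7b-p1` (row NE7b OWNER + CRUX PROVER; junction service for row NE7, ruling R-OWNER-149-1 (2)), generation 161.
Index `t4/b2b-balaban-t4-ne7b-p1/g161/INDEX.md`; memo `g161/records/SCOPING-G3.md`.
THE ARGUMENT (symmetry, no estimate).  Along the DIAGONAL curve `s ↦ Φ(s) :=` chart coordinates at `U` of `(chart_U(sX))^{e^{sY}}` one has `Φ(0) = 0`, `Φ′(0) = X + ξ_Y`,
`ξ_Y = skewPR (res (gaugeDir U Y))`, and BOTH `𝒜 = fineAction ∘ chart_U` (gauge invariance of the Wilson action, ✓ `fineAction_gaugeAct`) and `𝒢 = levelQ L N j U ∘ chart_U`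
(corner-trivial gauges fix the iterated average, ✓ `NE3ResidualSliceRep.cavgIter_gaugeAct_of_cornerTrivial`) take the same values on `Φ(s)` as on `sX`.  Differentiating twice:
`D²F(0)[X+ξ, X+ξ] + DF(0)[Φ″(0)] = D²F(0)[X, X]` for `F ∈ {𝒜, 𝒢}`; the combination `w·(·)_𝒜 − Λ(·)_𝒢` kills the `Φ″(0)` terms exactly when `w·D𝒜(0) = Λ ∘ D𝒢(0)`.
WHAT ([folklore]; 0 def, 0 sorry; every `d`, every `U(n)`):
* §1 `first_order_invariance` ∕ **`second_order_invariance`** — the abstract calculus over real normed spaces (✓ `NE7SecondOrderChainRuleVec.fderiv_fderiv_comp_vec`).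
* §2 the diagonal gauge curve at a unitary `M`-periodic base `U`, `X ∈ skewSub M`, `Y` a site field: `relLog_gaugeCurve_apply` (bond components), `hasDerivAt_gaugeCurve_inner`,
  `hasDerivAt_relLog_gaugeCurve`, `skewPR_coe`, **`hasDerivAt_gaugeCurve`** ∕ `fderiv_gaugeCurve_one` (`Φ′(0) = X + skewPR (res (gaugeDir U Y))`), `gaugeCurve_zero`,
  `contDiffAt_gaugeCurve`, **`eventually_chart_gaugeCurve`** (decoding: `chart_U(Φ(s)) = (chart_U(sX))^{e^{sY}}` near `0`, ✓ `chart_skewPR_relLog_eq`),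
  **`eventually_fineAction_gaugeCurve`**, `expGauge_corner_eq_one`, **`eventually_levelQ_gaugeCurve`** (row NE3-R2's multi-level class at `U` WITH ROOM: `SmallField U x`, `x < x′`,
  `LevelSmall d L j x′`; `Y` corner-trivial at scale `L^{j+1}`).
HONEST FRAMING (page 1): kinematics ∕ symmetry identities over landed kernel theorems; nothing of Bałaban's asserted; NOT (G), NOT NE7 as a spine node, NOT NE3; row NE7b NOT PRINTED ∕ NOT
PROVED; spine 0∕9; finite T⁴ rung (B)+1 — NOT infinite volume, NOT mass gap, NOT BetaPertH, NOT Clay.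
-/

set_option autoImplicit false

open scoped BigOperators Matrix Matrix.Norms.L2Operator Topology
open NormedSpace Finset Set Filter Metric

namespace Summit.QuantumFields.BalabanUV.T4Continuum.NE7DiagonalGaugeCurve

open Literature.MathematicalPhysics.QuantumFieldTheory.Balaban1983to89
open B7Prop1Explicit B7Prop2Explicit MatrixLog UnitaryModel
open T4AveragingDeficitWall (IsUnitaryCfg SmallField fineAction hasDerivAt_exp_smul_zero hasDerivAt_exp_neg_smul_zero)
open T4AveragingDeficitWallBoundary (IsPeriodicCfg)
open AveragingDeficitTorusChart (TDir chart chartDir chart_zero chart_smul resDir redN_boxVec isUnitaryCfg_chart isPeriodicCfg_chart)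
open AveragingDeficitChartCalculus (relLog relLog_self hasFDerivAt_mlog_one contDiffAt_val_chart contDiffAt_fineAction_chart)
open AveragingDeficitFermat (eventually_smallField_chart)
open AveragingDeficitTwoLevelPrep (skewSub skewPR skewPF skewPF_of_mem)
open AveragingDeficitMultiLevelPrep (tower cavgIter levelQ levelQ' LevelSmall)
open NE3EnergyShapes (IsUnitarySite IsPeriodicSite)
open NE3EnergyAssembly (fineAction_gaugeAct)
open NE3ResidualSliceRep (cavgIter_gaugeAct_of_cornerTrivial)
open NE7AdmissibleFibreLHC (chart_id_eq_chart_skewP period_succ_eq)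
open NE7TorusChartDecoding (chart_skewPR_relLog_eq)
open NE7FibreStraightening (contDiffAt_levelQ)
open NE7SecondOrderChainRuleVec (fderiv_fderiv_comp_vec fderiv_fderiv_comp_clm_vec)
open NE7ConstraintSecondDerivativeRecursion (fderiv_levelQ_chart)
open NE7MultiplierAnnihilatesGaugeDirections (expGauge_isUnitarySite)
open BlockAveragePushDirGauge (gaugeDir expGauge expGauge_zero gaugeAct_const_one isPeriodicCfg_gaugeAct_expGauge)
open AveragingDeficitKDatum (isUnitaryCfg_gaugeAct)

noncomputable section

variable {d : ℕ} {n : Type} [Fintype n] [DecidableEq n]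

/-! ## §1 The abstract calculus: second-order invariance along a curve, at a Lagrangian-critical point -/

section Abstract

variable {E S : Type*} [NormedAddCommGroup E] [NormedSpace ℝ E] [NormedAddCommGroup S] [NormedSpace ℝ S]

/-- **FIRST-ORDER INVARIANCE**: if a `C¹` map `𝒢` takes the same values along a `C¹` curve `Φ` (`Φ 0 = 0`) as along the ray `s ↦ sX`, then `D𝒢(0)[Φ′(0)] = D𝒢(0)[X]`. [folklore] -/
theorem first_order_invariance {𝒢 : E → S} {X : E} {Φ : ℝ → E} (h𝒢 : ContDiffAt ℝ 2 𝒢 0) (hΦ : ContDiffAt ℝ 2 Φ 0) (hΦ0 : Φ 0 = 0)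
    (hG : (fun s : ℝ => 𝒢 (Φ s)) =ᶠ[𝓝 0] fun s => 𝒢 (s • X)) :
    fderiv ℝ 𝒢 0 (fderiv ℝ Φ 0 1) = fderiv ℝ 𝒢 0 X := by
  set ℓ : ℝ →L[ℝ] E := (1 : ℝ →L[ℝ] ℝ).smulRight X with hℓ
  have hℓapp : ∀ s : ℝ, ℓ s = s • X := fun s => by simp [hℓ]
  have hG' : (fun s : ℝ => 𝒢 (Φ s)) =ᶠ[𝓝 0] fun s => 𝒢 (ℓ s) := hG.trans (Filter.Eventually.of_forall fun s => by simp only [hℓapp])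
  have h1 := hG'.fderiv_eq (𝕜 := ℝ)
  have hd𝒢 : DifferentiableAt ℝ 𝒢 (Φ 0) := by rw [hΦ0]; exact h𝒢.differentiableAt (by norm_num)
  have hdΦ : DifferentiableAt ℝ Φ 0 := hΦ.differentiableAt (by norm_num)
  have hL : fderiv ℝ (fun s : ℝ => 𝒢 (Φ s)) 0 = (fderiv ℝ 𝒢 (Φ 0)).comp (fderiv ℝ Φ 0) := fderiv_comp 0 hd𝒢 hdΦ
  have hd𝒢' : DifferentiableAt ℝ 𝒢 (ℓ 0) := by rw [map_zero]; exact h𝒢.differentiableAt (by norm_num)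
  have hR : fderiv ℝ (fun s : ℝ => 𝒢 (ℓ s)) 0 = (fderiv ℝ 𝒢 (ℓ 0)).comp (fderiv ℝ (⇑ℓ) 0) := fderiv_comp 0 hd𝒢' ℓ.differentiableAt
  rw [hL, hR, hΦ0, map_zero, ℓ.fderiv] at h1
  have h2 := congrArg (fun T : ℝ →L[ℝ] S => T 1) h1
  simpa [hℓapp] using h2

/-- **SECOND-ORDER INVARIANCE AT A LAGRANGIAN-CRITICAL POINT**: `𝒜 : E → ℝ`, `𝒢 : E → S` of class `C²` at `0`, `Λ : S →L ℝ`, `w : ℝ` with the multiplier identity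
`w·D𝒜(0)[Z] = Λ(D𝒢(0)[Z])` for all `Z`; if both `𝒜` and `𝒢` take the same values along a `C²` curve `Φ` (`Φ 0 = 0`) as along the ray `s ↦ sX`, then with `W = Φ′(0)`:
`w·D²𝒜(0)[W,W] − Λ(D²𝒢(0)[W,W]) = w·D²𝒜(0)[X,X] − Λ(D²𝒢(0)[X,X])` (the `Φ″(0)` terms cancel by criticality). [folklore] -/
theorem second_order_invariance {𝒜 : E → ℝ} {𝒢 : E → S} {Λ : S →L[ℝ] ℝ} {w : ℝ} {X : E} {Φ : ℝ → E}
    (h𝒜 : ContDiffAt ℝ 2 𝒜 0) (h𝒢 : ContDiffAt ℝ 2 𝒢 0) (hΦ : ContDiffAt ℝ 2 Φ 0) (hΦ0 : Φ 0 = 0)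
    (hcrit : ∀ Z : E, w * fderiv ℝ 𝒜 0 Z = Λ (fderiv ℝ 𝒢 0 Z))
    (hA : (fun s : ℝ => 𝒜 (Φ s)) =ᶠ[𝓝 0] fun s => 𝒜 (s • X)) (hG : (fun s : ℝ => 𝒢 (Φ s)) =ᶠ[𝓝 0] fun s => 𝒢 (s • X)) :
    w * fderiv ℝ (fderiv ℝ 𝒜) 0 (fderiv ℝ Φ 0 1) (fderiv ℝ Φ 0 1) - Λ (fderiv ℝ (fderiv ℝ 𝒢) 0 (fderiv ℝ Φ 0 1) (fderiv ℝ Φ 0 1))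
      = w * fderiv ℝ (fderiv ℝ 𝒜) 0 X X - Λ (fderiv ℝ (fderiv ℝ 𝒢) 0 X X) := by
  set ℓ : ℝ →L[ℝ] E := (1 : ℝ →L[ℝ] ℝ).smulRight X with hℓ
  have hℓapp : ∀ s : ℝ, ℓ s = s • X := fun s => by simp [hℓ]
  have hℓ0 : ℓ 0 = 0 := map_zero ℓ
  have hℓ1 : ℓ 1 = X := by rw [hℓapp, one_smul]
  -- the two second derivatives of `F ∘ Φ` and `F ∘ ℓ` agree, for `F = 𝒜` and `F = 𝒢`
  have hA' : (fun s : ℝ => 𝒜 (Φ s)) =ᶠ[𝓝 0] fun s => 𝒜 (ℓ s) := hA.trans (Filter.Eventually.of_forall fun s => by simp only [hℓapp])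
  have hG' : (fun s : ℝ => 𝒢 (Φ s)) =ᶠ[𝓝 0] fun s => 𝒢 (ℓ s) := hG.trans (Filter.Eventually.of_forall fun s => by simp only [hℓapp])
  have hA2 := congrArg (fun T : ℝ →L[ℝ] ℝ →L[ℝ] ℝ => T 1 1) ((hA'.fderiv (𝕜 := ℝ)).fderiv_eq (𝕜 := ℝ))
  have hG2 := congrArg (fun T : ℝ →L[ℝ] ℝ →L[ℝ] S => T 1 1) ((hG'.fderiv (𝕜 := ℝ)).fderiv_eq (𝕜 := ℝ))
  -- expand: left sides by the chain rule along `Φ`, right sides along the linear ray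
  have h𝒜Φ : ContDiffAt ℝ 2 𝒜 (Φ 0) := by rw [hΦ0]; exact h𝒜
  have h𝒢Φ : ContDiffAt ℝ 2 𝒢 (Φ 0) := by rw [hΦ0]; exact h𝒢
  have h𝒜ℓ : ContDiffAt ℝ 2 𝒜 (ℓ 0) := by rw [hℓ0]; exact h𝒜
  have h𝒢ℓ : ContDiffAt ℝ 2 𝒢 (ℓ 0) := by rw [hℓ0]; exact h𝒢
  rw [fderiv_fderiv_comp_vec h𝒜Φ hΦ 1 1, fderiv_fderiv_comp_clm_vec ℓ h𝒜ℓ 1 1, hΦ0, hℓ0, hℓ1] at hA2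
  rw [fderiv_fderiv_comp_vec h𝒢Φ hΦ 1 1, fderiv_fderiv_comp_clm_vec ℓ h𝒢ℓ 1 1, hΦ0, hℓ0, hℓ1] at hG2
  -- criticality kills the curvature of the curve
  have hc := hcrit (fderiv ℝ (fderiv ℝ Φ) 0 1 1)
  rw [← hA2, ← hG2, map_add]
  linarith [hc]

end Abstract

/-! ## §2 The diagonal gauge curve `s ↦` (chart coordinates at `U` of `(chart_U(sX))^{e^{sY}}`) -/

section Curve

variable {M : ℕ} [NeZero M]

/-- The bond components of the relative logarithm along the diagonal gauge curve:
`log(U(b)⁻¹ · e^{sY(x)} · (U(b) e^{sX(b)}) · e^{−sY(x+e_κ)})` at the torus bond `b = (boxVec M r, κ)`. [folklore] -/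
theorem relLog_gaugeCurve_apply (U : Site d → Fin d → (Matrix n n ℂ)ˣ) (X : ↥(skewSub d n M)) (Y : Site d → Matrix n n ℂ) (s : ℝ)
    (r : Fin d → Fin M) (κ : Fin d) :
    relLog M U (gaugeAct (expGauge Y s) (chart (ContinuousLinearMap.id ℝ (Matrix n n ℂ)) M U (s • (X : TDir d n M)))) r κ
      = mlog ((((U (boxVec M r) κ)⁻¹ : (Matrix n n ℂ)ˣ) : Matrix n n ℂ)
          * (exp ((s : ℂ) • Y (boxVec M r)) * (((U (boxVec M r) κ : (Matrix n n ℂ)ˣ) : Matrix n n ℂ) * exp ((s : ℂ) • (X : TDir d n M) r κ))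
              * exp (-((s : ℂ) • Y (boxVec M r + e κ))))) := by
  simp only [relLog, gaugeAct, chart, chartDir, ContinuousLinearMap.coe_id', id, redN_boxVec, expGauge, Units.val_mul, val_expUnit,
    val_inv_expUnit, Pi.smul_apply, Complex.coe_smul]

omit [NeZero M] in
/-- The inner unit of the relative logarithm along the curve has derivative `Y(x)·U(b) + U(b)·X(b) − U(b)·Y(x+e_κ)` (conjugated by `U(b)⁻¹`) at `s = 0`. [folklore] -/
theorem hasDerivAt_gaugeCurve_inner (U : Site d → Fin d → (Matrix n n ℂ)ˣ) (X : ↥(skewSub d n M)) (Y : Site d → Matrix n n ℂ)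
    (r : Fin d → Fin M) (κ : Fin d) :
    HasDerivAt (fun s : ℝ => (((U (boxVec M r) κ)⁻¹ : (Matrix n n ℂ)ˣ) : Matrix n n ℂ)
          * (exp ((s : ℂ) • Y (boxVec M r)) * (((U (boxVec M r) κ : (Matrix n n ℂ)ˣ) : Matrix n n ℂ) * exp ((s : ℂ) • (X : TDir d n M) r κ))
              * exp (-((s : ℂ) • Y (boxVec M r + e κ)))))
      ((((U (boxVec M r) κ)⁻¹ : (Matrix n n ℂ)ˣ) : Matrix n n ℂ)
          * (Y (boxVec M r) * ((U (boxVec M r) κ : (Matrix n n ℂ)ˣ) : Matrix n n ℂ)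
              + ((U (boxVec M r) κ : (Matrix n n ℂ)ˣ) : Matrix n n ℂ) * (X : TDir d n M) r κ
              - ((U (boxVec M r) κ : (Matrix n n ℂ)ˣ) : Matrix n n ℂ) * Y (boxVec M r + e κ))) 0 := by
  have h1 := hasDerivAt_exp_smul_zero (Y (boxVec M r))
  have h2 := (hasDerivAt_exp_smul_zero ((X : TDir d n M) r κ)).const_mul (((U (boxVec M r) κ : (Matrix n n ℂ)ˣ) : Matrix n n ℂ))
  have h3 := hasDerivAt_exp_neg_smul_zero (Y (boxVec M r + e κ))
  have h := ((h1.mul h2).mul h3).const_mul ((((U (boxVec M r) κ)⁻¹ : (Matrix n n ℂ)ˣ) : Matrix n n ℂ))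
  refine h.congr_deriv ?_
  simp only [Pi.mul_apply, Complex.ofReal_zero, zero_smul, neg_zero, exp_zero, one_mul, mul_one]
  noncomm_ring

omit [NeZero M] in
/-- At `s = 0` the inner unit is `1`. [folklore] -/
theorem gaugeCurve_inner_zero (U : Site d → Fin d → (Matrix n n ℂ)ˣ) (X : ↥(skewSub d n M)) (Y : Site d → Matrix n n ℂ)
    (r : Fin d → Fin M) (κ : Fin d) :
    (((U (boxVec M r) κ)⁻¹ : (Matrix n n ℂ)ˣ) : Matrix n n ℂ)
          * (exp (((0 : ℝ) : ℂ) • Y (boxVec M r)) * (((U (boxVec M r) κ : (Matrix n n ℂ)ˣ) : Matrix n n ℂ) * exp (((0 : ℝ) : ℂ) • (X : TDir d n M) r κ))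
              * exp (-(((0 : ℝ) : ℂ) • Y (boxVec M r + e κ)))) = 1 := by
  simp only [Complex.ofReal_zero, zero_smul, neg_zero, exp_zero, one_mul, mul_one, Units.inv_mul]

/-- **THE DERIVATIVE OF THE DIAGONAL GAUGE CURVE**: the relative logarithm along the curve has derivative `res (gaugeDir U Y) + X` at `s = 0` (bond by bond:
`Ad_{U(b)⁻¹} Y(x) + X(b) − Y(x + e_κ)`, through `D log(1) = id`). [folklore] -/
theorem hasDerivAt_relLog_gaugeCurve (U : Site d → Fin d → (Matrix n n ℂ)ˣ) (X : ↥(skewSub d n M)) (Y : Site d → Matrix n n ℂ) :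
    HasDerivAt (fun s : ℝ => relLog M U (gaugeAct (expGauge Y s) (chart (ContinuousLinearMap.id ℝ (Matrix n n ℂ)) M U (s • (X : TDir d n M)))))
      (resDir M (gaugeDir U Y) + (X : TDir d n M)) 0 := by
  refine hasDerivAt_pi.mpr fun r => hasDerivAt_pi.mpr fun κ => ?_
  have hin := hasDerivAt_gaugeCurve_inner U X Y r κ
  have hm := (hasFDerivAt_mlog_one (n := n)).restrictScalars ℝ
  rw [← gaugeCurve_inner_zero U X Y r κ] at hm
  have hc := hm.comp_hasDerivAt (0 : ℝ) hin
  have hder : (ContinuousLinearMap.restrictScalars ℝ (ContinuousLinearMap.id ℂ (Matrix n n ℂ)))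
      ((((U (boxVec M r) κ)⁻¹ : (Matrix n n ℂ)ˣ) : Matrix n n ℂ)
          * (Y (boxVec M r) * ((U (boxVec M r) κ : (Matrix n n ℂ)ˣ) : Matrix n n ℂ)
              + ((U (boxVec M r) κ : (Matrix n n ℂ)ˣ) : Matrix n n ℂ) * (X : TDir d n M) r κ
              - ((U (boxVec M r) κ : (Matrix n n ℂ)ˣ) : Matrix n n ℂ) * Y (boxVec M r + e κ)))
      = (resDir M (gaugeDir U Y) + (X : TDir d n M)) r κ := by
    simp only [ContinuousLinearMap.coe_restrictScalars', ContinuousLinearMap.id_apply, Pi.add_apply, resDir, gaugeDir, T4AveragingDeficitWall.Ad,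
      inv_inv, mul_add, mul_sub, ← mul_assoc, Units.inv_mul, one_mul]
    abel
  rw [hder] at hc
  refine hc.congr_of_eventuallyEq (Filter.Eventually.of_forall fun s => ?_)
  simp only [Function.comp, relLog_gaugeCurve_apply]

omit [DecidableEq n] [NeZero M] in
/-- `skewPR` is the identity on `skewSub`. [folklore] -/
theorem skewPR_coe (X : ↥(skewSub d n M)) : skewPR (d := d) (n := n) M (X : TDir d n M) = X :=
  Subtype.ext (skewPF_of_mem X.2)

/-- **THE DIAGONAL GAUGE CURVE IN `skewSub`**: value `0` and derivative `X + skewPR (res (gaugeDir U Y))` at `s = 0`. [folklore] -/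
theorem hasDerivAt_gaugeCurve (U : Site d → Fin d → (Matrix n n ℂ)ˣ) (X : ↥(skewSub d n M)) (Y : Site d → Matrix n n ℂ) :
    HasDerivAt (fun s : ℝ => skewPR (d := d) (n := n) M
        (relLog M U (gaugeAct (expGauge Y s) (chart (ContinuousLinearMap.id ℝ (Matrix n n ℂ)) M U (s • (X : TDir d n M))))))
      (X + skewPR (d := d) (n := n) M (resDir M (gaugeDir U Y))) 0 := by
  have h := (skewPR (d := d) (n := n) M).hasFDerivAt.comp_hasDerivAt (0 : ℝ) (hasDerivAt_relLog_gaugeCurve U X Y)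
  rw [map_add, skewPR_coe, add_comm] at h
  exact h

/-- The diagonal gauge curve starts at `0`. [folklore] -/
theorem gaugeCurve_zero (U : Site d → Fin d → (Matrix n n ℂ)ˣ) (X : ↥(skewSub d n M)) (Y : Site d → Matrix n n ℂ) :
    skewPR (d := d) (n := n) M
        (relLog M U (gaugeAct (expGauge Y 0) (chart (ContinuousLinearMap.id ℝ (Matrix n n ℂ)) M U ((0 : ℝ) • (X : TDir d n M))))) = 0 := by
  rw [expGauge_zero, gaugeAct_const_one, zero_smul, chart_zero, relLog_self, map_zero]

/-- The diagonal gauge curve is smooth at `s = 0` (products of exponentials, the series logarithm near `1`, a linear projection). [folklore] -/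
theorem contDiffAt_gaugeCurve {m : WithTop ℕ∞} (U : Site d → Fin d → (Matrix n n ℂ)ˣ) (X : ↥(skewSub d n M)) (Y : Site d → Matrix n n ℂ) :
    ContDiffAt ℝ m (fun s : ℝ => skewPR (d := d) (n := n) M
        (relLog M U (gaugeAct (expGauge Y s) (chart (ContinuousLinearMap.id ℝ (Matrix n n ℂ)) M U (s • (X : TDir d n M)))))) 0 := by
  refine (skewPR (d := d) (n := n) M).contDiff.contDiffAt.comp 0 ?_
  refine contDiffAt_pi.mpr fun r => contDiffAt_pi.mpr fun κ => ?_
  -- the inner unit is smooth in `s`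
  have hsmul : ∀ B : Matrix n n ℂ, ContDiff ℝ m (fun s : ℝ => (s : ℂ) • B) := fun B =>
    (Complex.ofRealCLM.contDiff.smul contDiff_const)
  have hexp : ∀ B : Matrix n n ℂ, ContDiff ℝ m (fun s : ℝ => exp ((s : ℂ) • B)) := fun B =>
    contDiff_iff_contDiffAt.mpr fun s => (exp_analytic (𝕂 := ℝ) _).contDiffAt.comp s (hsmul B).contDiffAt
  have hexpn : ∀ B : Matrix n n ℂ, ContDiff ℝ m (fun s : ℝ => exp (-((s : ℂ) • B))) := fun B =>
    contDiff_iff_contDiffAt.mpr fun s => (exp_analytic (𝕂 := ℝ) _).contDiffAt.comp s (hsmul B).neg.contDiffAt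
  have hin : ContDiffAt ℝ m (fun s : ℝ => (((U (boxVec M r) κ)⁻¹ : (Matrix n n ℂ)ˣ) : Matrix n n ℂ)
          * (exp ((s : ℂ) • Y (boxVec M r)) * (((U (boxVec M r) κ : (Matrix n n ℂ)ˣ) : Matrix n n ℂ) * exp ((s : ℂ) • (X : TDir d n M) r κ))
              * exp (-((s : ℂ) • Y (boxVec M r + e κ))))) 0 :=
    contDiffAt_const.mul ((((hexp _).contDiffAt.mul (contDiffAt_const.mul (hexp _).contDiffAt)).mul (hexpn _).contDiffAt))
  have h1 : ‖(((U (boxVec M r) κ)⁻¹ : (Matrix n n ℂ)ˣ) : Matrix n n ℂ)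
          * (exp (((0 : ℝ) : ℂ) • Y (boxVec M r)) * (((U (boxVec M r) κ : (Matrix n n ℂ)ˣ) : Matrix n n ℂ) * exp (((0 : ℝ) : ℂ) • (X : TDir d n M) r κ))
              * exp (-(((0 : ℝ) : ℂ) • Y (boxVec M r + e κ)))) - 1‖ < 1 := by
    rw [gaugeCurve_inner_zero, sub_self, norm_zero]; exact one_pos
  have hg : ContDiffAt ℝ m (mlog : Matrix n n ℂ → Matrix n n ℂ) ((((U (boxVec M r) κ)⁻¹ : (Matrix n n ℂ)ˣ) : Matrix n n ℂ)
          * (exp (((0 : ℝ) : ℂ) • Y (boxVec M r)) * (((U (boxVec M r) κ : (Matrix n n ℂ)ˣ) : Matrix n n ℂ) * exp (((0 : ℝ) : ℂ) • (X : TDir d n M) r κ))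
              * exp (-(((0 : ℝ) : ℂ) • Y (boxVec M r + e κ))))) :=
    ((analyticAt_mlog h1).contDiffAt).restrict_scalars ℝ
  have hcomp := hg.comp 0 hin
  refine hcomp.congr_of_eventuallyEq (Filter.Eventually.of_forall fun s => ?_)
  simp only [Function.comp, relLog_gaugeCurve_apply]

/-- `fderiv` of the diagonal gauge curve at `0` applied to `1`: `X + skewPR (res (gaugeDir U Y))`. [folklore] -/
theorem fderiv_gaugeCurve_one (U : Site d → Fin d → (Matrix n n ℂ)ˣ) (X : ↥(skewSub d n M)) (Y : Site d → Matrix n n ℂ) :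
    fderiv ℝ (fun s : ℝ => skewPR (d := d) (n := n) M
        (relLog M U (gaugeAct (expGauge Y s) (chart (ContinuousLinearMap.id ℝ (Matrix n n ℂ)) M U (s • (X : TDir d n M)))))) 0 1
      = X + skewPR (d := d) (n := n) M (resDir M (gaugeDir U Y)) := by
  rw [(hasDerivAt_gaugeCurve U X Y).hasFDerivAt.fderiv]
  simp

/-- **DECODING**: for unitary `M`-periodic `U` and `𝔲(n)`-valued `M`-periodic `Y`, near `s = 0` the chart point of the curve IS the gauge transform:
`chart_U(Φ(s)) = (chart_U(sX))^{e^{sY}}` (✓ `chart_skewPR_relLog_eq`). [folklore] -/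
theorem eventually_chart_gaugeCurve [Nonempty n] {U : Site d → Fin d → (Matrix n n ℂ)ˣ} (hU : IsUnitaryCfg U) (hUP : IsPeriodicCfg U (M : ℤ)) (X : ↥(skewSub d n M))
    {Y : Site d → Matrix n n ℂ} (hY : ∀ x, Y x ∈ skewAdjoint (Matrix n n ℂ)) (hYP : ∀ (x : Site d) (i : Fin d), Y (x + (M : ℤ) • e i) = Y x) :
    ∀ᶠ s in 𝓝 (0 : ℝ),
      chart (ContinuousLinearMap.id ℝ (Matrix n n ℂ)) M U ((skewPR (d := d) (n := n) M
          (relLog M U (gaugeAct (expGauge Y s) (chart (ContinuousLinearMap.id ℝ (Matrix n n ℂ)) M U (s • (X : TDir d n M))))) : ↥(skewSub d n M)) : TDir d n M)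
        = gaugeAct (expGauge Y s) (chart (ContinuousLinearMap.id ℝ (Matrix n n ℂ)) M U (s • (X : TDir d n M))) := by
  -- nearness on the finitely many torus bonds, by continuity at `s = 0`
  have hnear : ∀ᶠ s in 𝓝 (0 : ℝ), ∀ rκ : (Fin d → Fin M) × Fin d,
      ‖(((U (boxVec M rκ.1) rκ.2)⁻¹ : (Matrix n n ℂ)ˣ) : Matrix n n ℂ)
          * ((gaugeAct (expGauge Y s) (chart (ContinuousLinearMap.id ℝ (Matrix n n ℂ)) M U (s • (X : TDir d n M))) (boxVec M rκ.1) rκ.2 : (Matrix n n ℂ)ˣ) : Matrix n n ℂ)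
          - 1‖ ≤ 1 / 4 := by
    refine Filter.eventually_all.mpr fun rκ => ?_
    have hfun : (fun s : ℝ => (((U (boxVec M rκ.1) rκ.2)⁻¹ : (Matrix n n ℂ)ˣ) : Matrix n n ℂ)
          * ((gaugeAct (expGauge Y s) (chart (ContinuousLinearMap.id ℝ (Matrix n n ℂ)) M U (s • (X : TDir d n M))) (boxVec M rκ.1) rκ.2 : (Matrix n n ℂ)ˣ) : Matrix n n ℂ))
        = fun s : ℝ => (((U (boxVec M rκ.1) rκ.2)⁻¹ : (Matrix n n ℂ)ˣ) : Matrix n n ℂ)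
          * (exp ((s : ℂ) • Y (boxVec M rκ.1)) * (((U (boxVec M rκ.1) rκ.2 : (Matrix n n ℂ)ˣ) : Matrix n n ℂ) * exp ((s : ℂ) • (X : TDir d n M) rκ.1 rκ.2))
              * exp (-((s : ℂ) • Y (boxVec M rκ.1 + e rκ.2)))) := by
      funext s
      simp only [gaugeAct, chart, chartDir, ContinuousLinearMap.coe_id', id, redN_boxVec, expGauge, Units.val_mul, val_expUnit,
        val_inv_expUnit, Pi.smul_apply, Complex.coe_smul]
    have hcA : ContinuousAt (fun s : ℝ => (((U (boxVec M rκ.1) rκ.2)⁻¹ : (Matrix n n ℂ)ˣ) : Matrix n n ℂ)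
          * ((gaugeAct (expGauge Y s) (chart (ContinuousLinearMap.id ℝ (Matrix n n ℂ)) M U (s • (X : TDir d n M))) (boxVec M rκ.1) rκ.2 : (Matrix n n ℂ)ˣ) : Matrix n n ℂ)) 0 := by
      rw [hfun]
      exact (hasDerivAt_gaugeCurve_inner U X Y rκ.1 rκ.2).continuousAt
    have hc : ContinuousAt (fun s : ℝ => ‖(((U (boxVec M rκ.1) rκ.2)⁻¹ : (Matrix n n ℂ)ˣ) : Matrix n n ℂ)
          * ((gaugeAct (expGauge Y s) (chart (ContinuousLinearMap.id ℝ (Matrix n n ℂ)) M U (s • (X : TDir d n M))) (boxVec M rκ.1) rκ.2 : (Matrix n n ℂ)ˣ) : Matrix n n ℂ)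
          - 1‖) 0 := (hcA.sub continuousAt_const).norm
    have h0 : ‖(((U (boxVec M rκ.1) rκ.2)⁻¹ : (Matrix n n ℂ)ˣ) : Matrix n n ℂ)
          * ((gaugeAct (expGauge Y 0) (chart (ContinuousLinearMap.id ℝ (Matrix n n ℂ)) M U ((0 : ℝ) • (X : TDir d n M))) (boxVec M rκ.1) rκ.2 : (Matrix n n ℂ)ˣ) : Matrix n n ℂ)
          - 1‖ < 1 / 4 := by
      rw [expGauge_zero, gaugeAct_const_one, zero_smul, chart_zero, Units.inv_mul, sub_self, norm_zero]; norm_num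
    exact (hc.eventually (gt_mem_nhds h0)).mono fun s hs => hs.le
  refine hnear.mono fun s hs => ?_
  have hXu : IsUnitaryCfg (chart (ContinuousLinearMap.id ℝ (Matrix n n ℂ)) M U (s • (X : TDir d n M))) := by
    rw [chart_id_eq_chart_skewP U ((skewSub d n M).smul_mem s X.2)]
    exact isUnitaryCfg_chart M hU _
  exact chart_skewPR_relLog_eq hU (isUnitaryCfg_gaugeAct (expGauge_isUnitarySite hY s) hXu) hUP
    (isPeriodicCfg_gaugeAct_expGauge (isPeriodicCfg_chart (ContinuousLinearMap.id ℝ (Matrix n n ℂ)) M hUP _) hYP s) fun r κ => hs (r, κ)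

/-- **INVARIANCE OF THE WILSON ACTION along the diagonal gauge curve**: `fineAction (chart_U(Φ(s))) W = fineAction (chart_U(sX)) W` near `s = 0` (✓ `fineAction_gaugeAct`). [folklore] -/
theorem eventually_fineAction_gaugeCurve [Nonempty n] {U : Site d → Fin d → (Matrix n n ℂ)ˣ} (hU : IsUnitaryCfg U) (hUP : IsPeriodicCfg U (M : ℤ))
    (X : ↥(skewSub d n M)) {Y : Site d → Matrix n n ℂ} (hY : ∀ x, Y x ∈ skewAdjoint (Matrix n n ℂ))
    (hYP : ∀ (x : Site d) (i : Fin d), Y (x + (M : ℤ) • e i) = Y x) (Wn : Finset (T4AveragingDeficitWall.Plaq d)) :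
    (fun s : ℝ => fineAction (chart (ContinuousLinearMap.id ℝ (Matrix n n ℂ)) M U ((skewPR (d := d) (n := n) M
          (relLog M U (gaugeAct (expGauge Y s) (chart (ContinuousLinearMap.id ℝ (Matrix n n ℂ)) M U (s • (X : TDir d n M))))) : ↥(skewSub d n M)) : TDir d n M)) Wn)
      =ᶠ[𝓝 0] fun s : ℝ => fineAction (chart (ContinuousLinearMap.id ℝ (Matrix n n ℂ)) M U (s • (X : TDir d n M))) Wn := by
  filter_upwards [eventually_chart_gaugeCurve hU hUP X hY hYP] with s hs
  rw [hs, fineAction_gaugeAct]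

/-- Corner-trivial gauge parameters generate corner-trivial gauge transformations. [folklore] -/
theorem expGauge_corner_eq_one {Y : Site d → Matrix n n ℂ} {K : ℤ} (hYc : ∀ z : Site d, Y (K • z) = 0) (s : ℝ) (z : Site d) :
    expGauge Y s (K • z) = 1 := by
  apply Units.ext
  show exp ((s : ℂ) • Y (K • z)) = 1
  rw [hYc z, smul_zero, exp_zero]

/-- **INVARIANCE OF THE MULTI-LEVEL CONSTRAINT along the diagonal gauge curve** (row NE3-R2's multi-level class at the base `U` WITH ROOM: `SmallField U x`, `x < x′`,
`LevelSmall d L j x′`; `Y` corner-trivial at scale `L^{j+1}`): `levelQ L N j U (chart_U(Φ(s))) = levelQ L N j U (chart_U(sX))` near `s = 0` — corner-trivial gauges fix the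
`(j+1)`-fold average (✓ `cavgIter_gaugeAct_of_cornerTrivial`). [folklore] -/
theorem eventually_levelQ_gaugeCurve [Nonempty n] {L N : ℕ} [NeZero L] [NeZero N] (hL : 1 ≤ L) (j : ℕ)
    {U : Site d → Fin d → (Matrix n n ℂ)ˣ} {x x' : ℝ} (hU : IsUnitaryCfg U) (hUP : IsPeriodicCfg U ((L * tower L N j : ℕ) : ℤ))
    (hx : 0 ≤ x) (hxx' : x < x') (hs' : LevelSmall d L j x') (hUx : SmallField U x) (X : ↥(skewSub d n (L * tower L N j)))
    {Y : Site d → Matrix n n ℂ} (hY : ∀ x, Y x ∈ skewAdjoint (Matrix n n ℂ))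
    (hYP : ∀ (z : Site d) (i : Fin d), Y (z + ((L * tower L N j : ℕ) : ℤ) • e i) = Y z) (hYc : ∀ z : Site d, Y (((L : ℤ) ^ (j + 1)) • z) = 0) :
    (fun s : ℝ => levelQ L N j U (chart (ContinuousLinearMap.id ℝ (Matrix n n ℂ)) (L * tower L N j) U ((skewPR (d := d) (n := n) (L * tower L N j)
          (relLog (L * tower L N j) U (gaugeAct (expGauge Y s) (chart (ContinuousLinearMap.id ℝ (Matrix n n ℂ)) (L * tower L N j) U (s • (X : TDir d n (L * tower L N j)))))) :
            ↥(skewSub d n (L * tower L N j))) : TDir d n (L * tower L N j))))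
      =ᶠ[𝓝 0] fun s : ℝ => levelQ L N j U (chart (ContinuousLinearMap.id ℝ (Matrix n n ℂ)) (L * tower L N j) U (s • (X : TDir d n (L * tower L N j)))) := by
  -- the perturbed configuration stays in the class radius `x′` near `s = 0`
  have hsf : ∀ᶠ s in 𝓝 (0 : ℝ), SmallField (chart (ContinuousLinearMap.id ℝ (Matrix n n ℂ)) (L * tower L N j) U (s • (X : TDir d n (L * tower L N j)))) x' := by
    have h := eventually_smallField_chart (ContinuousLinearMap.id ℝ (Matrix n n ℂ)) (L * tower L N j) hUP hxx' hUx
    have ht : Tendsto (fun s : ℝ => s • (X : TDir d n (L * tower L N j))) (𝓝 0) (𝓝 0) := by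
      have hc : Continuous fun s : ℝ => s • (X : TDir d n (L * tower L N j)) := continuous_id.smul continuous_const
      simpa using hc.tendsto 0
    exact ht.eventually h
  filter_upwards [eventually_chart_gaugeCurve hU hUP X hY hYP, hsf] with s hs hsx
  rw [hs]
  have hWu : IsUnitaryCfg (chart (ContinuousLinearMap.id ℝ (Matrix n n ℂ)) (L * tower L N j) U (s • (X : TDir d n (L * tower L N j)))) := by
    rw [chart_id_eq_chart_skewP U ((skewSub d n (L * tower L N j)).smul_mem s X.2)]
    exact isUnitaryCfg_chart (L * tower L N j) hU _
  have hcov := cavgIter_gaugeAct_of_cornerTrivial hL j hWu (hx.trans hxx'.le) hs' hsx (expGauge_isUnitarySite hY s)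
    (fun z => expGauge_corner_eq_one hYc s z)
  simp only [levelQ]
  rw [hcov]

end Curve

end

end Summit.QuantumFields.BalabanUV.T4Continuum.NE7DiagonalGaugeCurve
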